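import Mathlib
import Summits.NavierStokesRegularity.NavierStokesRegularity.Theses.ClockStretchingLaw
import Summits.NavierStokesRegularity.NavierStokesRegularity.Theorems.ClockStretchingLawClockCeilingSingularStretchingNearZero
import Summits.NavierStokesRegularity.NavierStokesRegularity.Theorems.ClockStretchingLawClockCeilingIffTarget
import Summits.NavierStokesRegularity.NavierStokesRegularity.Theorems.ClockStretchingLawClockCeilingUnidirectionalVorticityLiouville
import Literature.Analysis.FluidPDE.TypeIAncientMild
import HarnessLib

/-!
# Route ClockStretchingLaw, crux `ClockCeiling` (stmt-NavierStokesRegularity-10570) — Giga–Miura's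
# continuous-alignment criterion for the Type-I class: a singular Type-I model has a wildly turning
# vorticity direction

Line `registered`, lead c7, stubs `stub_continuousAlignmentRegular` and
`stub_clockCeilingOfContinuousAlignment` (`--supports 10570`).

Giga–Miura (Commun. Math. Phys. 303 (2011), Thm 1.1; restated as Thm 1.1 of Giga–Gu–Hsu 2019):
a spatially bounded mild solution with a Type-I bound `sup (−t)^{1/2}‖u(t)‖_∞ < ∞` whose vorticity
direction `ξ = ω/|ω|` admits a `t`-uniform spatial modulus of continuity `η` on the high-vorticity
set `{|ω| > d} ∩ (ℝ³ × (−1,0))` is bounded up to `t = 0` — "type I blow-up does not occur unless the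
vorticity direction is wildly changing depending on space". This file proves the statement INSIDE
the route's Type-I model class `𝒦_C` (Type-I KNSS-mild + scale-invariant energy ledger), with the
conclusion "regular at the space-time origin" (the class is translation covariant, so this is
regularity at every point of `t = 0`):

* `continuousAlignmentRegular` / `stub_continuousAlignmentRegular` — continuous alignment ⇒ the
  origin is a regular point (not singular in the sense of `NoSingularTypeIModel`);
* `continuousAlignmentRegular_at` — the same at EVERY point `(x₁, 0)` of the final time (translation
  covariance of `𝒦_C`: `translationInvariantAfter_isTypeIAncientMild_comp_add_right`,
  `energyLedger_comp_add_right`), i.e. Giga–Miura's conclusion pointwise on `t = 0`;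
* `stub_clockCeilingOfContinuousAlignment` — hence `ClockCeiling`'s conclusion holds along every
  continuously aligned element of `𝒦_C` (`clockCeiling_of_regularOrigin`, p152790).

Contrapositive = a new PORTRAIT CLAUSE of any counterexample to the crux / to the Type-I Liouville
node: a singular Type-I model has, for every `d ≥ 0` and every modulus `η → 0⁺`, pairs of points of
equal time in `(−1,0)` with `|ω| > d` at both and `‖ξ(t,x) − ξ(t,y)‖ > η(‖x − y‖)`.

## Proof (Giga–Miura's blow-up argument run inside the class)

Template: `ClockStretchingLawClockCeilingSingularStretchingNearZero.lean`. Were `u` singular at the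
origin, the zooms `u_c = c u(c²·, c·)`, `c_j = 1/(j+1)`, subconverge pointwise together with their
gradients (`stub_zoomExtraction`, `tendsto_fderiv_apply_of_typeI` under the class-uniform KNSS
Hessian bound `uniformBounds_exists_mixed`) to a SINGULAR (`stub_limitSingular`,
`classPressure_holds`), hence nonzero, `W ∈ 𝒦_C`. At two points of a slice `t < 0` where
`curl W ≠ 0`, the zoomed vorticities are eventually nonzero and exceed `d c²` before zooming
(`norm_curl_nsZoom_origin`), their directions are those of `u` at the zoomed points
(`vorticityDirection_nsZoom_origin`), and differ by at most `η(c_j‖x − y‖) → 0`. Hence all nonzero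
vorticity vectors of a slice of `W` share one direction (`exists_parallel_of_direction_eq`), and
`W ≡ 0` by the unidirectional Liouville theorem `unidirectionalVorticityLiouville` — contradiction.

## References

* Y. Giga, H. Miura, Commun. Math. Phys. 303 (2011) 289–300, Thm 1.1. [GigaMiura2011]
* Y. Giga, Z. Gu, P.-Y. Hsu, Nonlinear Anal. 189 (2019) 111579, Thm 1.1, §2.4
  (held: paper:doi-10-1016-j-na-2019-111579 pp. 3, 7). [GigaGuHsu2019]
* D. Albritton, T. Barker, ARMA 232 (2019), Lemma 2.2, Prop. 2.3 (persistence of singularities,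
  arXiv:1811.00502). [AlbrittonBarker2019]
* G. Koch, N. Nadirashvili, G. Seregin, V. Šverák, Acta Math. 203 (2009), Prop. 4.1
  (arXiv:0709.3599). [KochNadirashviliSereginSverak2009]
-/

noncomputable section

-- the summit and its single sub-problem share the name (CONVENTIONS §1), as in every Theorems file
set_option linter.dupNamespace false

open Set Function Filter Topology Metric MeasureTheory
open scoped RealInnerProductSpace

namespace Summit.NavierStokesRegularity.NavierStokesRegularity.Theorems

open Literature.Analysis Literature.Analysis.FluidPDE
open Summit.NavierStokesRegularity.NavierStokesRegularity.Theorems.ClockLaw.Birth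

/-! ### Zoom covariance of the vorticity direction -/

/-- **The vorticity direction is zoom invariant**: for `0 < c`, the direction field of the zoom
`u_c = c u(c² ·, c ·)` at `(t, x)` is the direction field of `u` at `(c² t, c x)`
(`curl u_c (t, x) = c² ω(c² t, c x)` and `c² > 0` drops out of `ω/|ω|`). [folklore] -/
theorem vorticityDirection_nsZoom_origin {c : ℝ} (hc : 0 < c)
    (u : ℝ → EuclideanSpace ℝ (Fin 3) → EuclideanSpace ℝ (Fin 3)) (t : ℝ)
    (x : EuclideanSpace ℝ (Fin 3)) :
    vorticityDirection (curl ((c • stPull (c ^ 2) c 0 0 u) t)) x =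
      vorticityDirection (curl (u (c ^ 2 * t))) (c • x) := by
  rw [vorticityDirection_apply, vorticityDirection_apply, curl_nsZoom_origin,
    inv_norm_smul_smul_of_pos (mul_pos hc hc)]

/-- **Norm of the zoomed vorticity**: `‖curl u_c (t, x)‖ = c² ‖ω(c² t, c x)‖` for `0 < c`. [folklore] -/
theorem norm_curl_nsZoom_origin {c : ℝ} (hc : 0 < c)
    (u : ℝ → EuclideanSpace ℝ (Fin 3) → EuclideanSpace ℝ (Fin 3)) (t : ℝ)
    (x : EuclideanSpace ℝ (Fin 3)) :
    ‖curl ((c • stPull (c ^ 2) c 0 0 u) t) x‖ = (c * c) * ‖curl (u (c ^ 2 * t)) (c • x)‖ := by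
  rw [curl_nsZoom_origin, norm_smul, Real.norm_of_nonneg (mul_pos hc hc).le]

/-! ### Unidirectional slices from pairwise alignment -/

/-- If on a slice all nonzero vorticity vectors have the same direction (`ξ(x) = ξ(y)` whenever
`ω(x), ω(y) ≠ 0`), then the vorticity of the slice is everywhere parallel to one nonzero vector. [folklore] -/
theorem exists_parallel_of_direction_eq {ω : EuclideanSpace ℝ (Fin 3) → EuclideanSpace ℝ (Fin 3)}
    (h : ∀ x y, ω x ≠ 0 → ω y ≠ 0 → vorticityDirection ω x = vorticityDirection ω y) :
    ∃ e : EuclideanSpace ℝ (Fin 3), e ≠ 0 ∧ ∀ y, ∃ a : ℝ, ω y = a • e := by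
  by_cases hex : ∃ x₀, ω x₀ ≠ 0
  · obtain ⟨x₀, hx₀⟩ := hex
    refine ⟨vorticityDirection ω x₀, fun h0 => hx₀ ((vorticityDirection_eq_zero_iff ω x₀).1 h0),
      fun y => ?_⟩
    by_cases hy : ω y = 0
    · exact ⟨0, by rw [hy, zero_smul]⟩
    · refine ⟨‖ω y‖, ?_⟩
      rw [← h y x₀ hy hx₀, vorticityDirection_apply, smul_smul,
        mul_inv_cancel₀ (norm_ne_zero_iff.2 hy), one_smul]
  · push Not at hex
    refine ⟨EuclideanSpace.single 0 1, fun h0 => ?_, fun y => ⟨0, by rw [hex y, zero_smul]⟩⟩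
    have := congr_arg (fun v : EuclideanSpace ℝ (Fin 3) => v 0) h0
    simp at this

/-! ### Giga–Miura for the Type-I class -/

/-- **Continuous alignment of the vorticity direction forces regularity of a Type-I model at the
origin** — Giga–Miura 2011, Thm 1.1 ("type I blow-up does not occur unless the vorticity direction
is wildly changing depending on space") in the language of the route's class `𝒦_C`. Let
`u ∈ 𝒦_C` (Type-I KNSS-mild with the energy ledger `A, E ≤ C`), `d ≥ 0`, and let `η` be a modulus
with `η(r) → 0` as `r → 0⁺` such that on the slab `ℝ³ × (−1, 0)` the vorticity direction
`ξ = ω/|ω|` obeys `‖ξ(t,x) − ξ(t,y)‖ ≤ η(‖x − y‖)` whenever `‖ω(t,x)‖, ‖ω(t,y)‖ > d`. Then `u`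
is bounded on some backward parabolic cylinder `Q(0, r)`.

Proof (Giga–Miura's blow-up argument run inside the class). If `u` were singular at the origin,
the zooms `u_c = c u(c² ·, c ·)`, `c = 1/(j+1) → 0`, subconverge pointwise with their gradients to a
SINGULAR, hence nonzero, element `W ∈ 𝒦_C` (`stub_zoomExtraction`, persistence
`stub_limitSingular` + `classPressure_holds`, `tendsto_fderiv_apply_of_typeI`). At two points
`x, y` of a slice `t < 0` where `curl W ≠ 0` the zoomed vorticities are eventually nonzero, of
size `> d c²` before zooming, and their directions — the directions of `u` at `(c²t, cx), (c²t, cy)`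
— differ by at most `η(c‖x − y‖) → 0`; so `ξ_W(t,x) = ξ_W(t,y)`: every slice of `W` has
unidirectional vorticity, and `W ≡ 0` by `unidirectionalVorticityLiouville` — contradiction.
(Restated with proof sketch in Giga–Gu–Hsu 2019, Thm 1.1 and §2.4 [GigaGuHsu2019].) [cite: GigaMiura2011, Thm 1.1 (Commun. Math. Phys. 303 (2011) 289–300)] -/
theorem continuousAlignmentRegular {C : ℝ}
    {u : ℝ → EuclideanSpace ℝ (Fin 3) → EuclideanSpace ℝ (Fin 3)} (hu : IsTypeIAncientMild C u)
    (hE : ∀ (x₀ : EuclideanSpace ℝ (Fin 3)) (t₀ r : ℝ), t₀ ≤ 0 → 0 < r →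
      (∀ t, t₀ - r ^ 2 < t → t < t₀ → r⁻¹ * ∫ x in Metric.ball x₀ r, ‖u t x‖ ^ 2 ≤ C) ∧
        r⁻¹ * ∫ t in Set.Ioo (t₀ - r ^ 2) t₀, ∫ x in Metric.ball x₀ r, ‖fderiv ℝ (u t) x‖ ^ 2 ≤ C)
    {d : ℝ} {η : ℝ → ℝ} (hη : Tendsto η (𝓝[>] 0) (𝓝 0))
    (halign : ∀ t ∈ Set.Ioo (-1 : ℝ) 0, ∀ x y : EuclideanSpace ℝ (Fin 3),
      d < ‖curl (u t) x‖ → d < ‖curl (u t) y‖ →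
        ‖vorticityDirection (curl (u t)) x - vorticityDirection (curl (u t)) y‖ ≤ η ‖x - y‖) :
    ¬ (∀ r > 0, ∀ M : ℝ, ∃ t ∈ Set.Ioo (-(r ^ 2)) (0 : ℝ),
      ∃ x ∈ Metric.ball (0 : EuclideanSpace ℝ (Fin 3)) r, M < ‖u t x‖) := by
  intro hsing
  -- the zooms `u_{c_j}`, `c_j = 1/(j+1) → 0`
  set c : ℕ → ℝ := fun j => 1 / ((j : ℝ) + 1) with hcdef
  have hc : ∀ j, 0 < c j := fun j => by rw [hcdef]; positivity
  obtain ⟨φ, hφ, W, hW, -, hpt⟩ := stub_zoomExtraction C u hu hE c hc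
  -- the limit is singular at the origin, hence nonzero somewhere
  have hWsing := stub_limitSingular classPressure_holds C u hu hE hsing (fun j => c (φ j))
    (fun j => hc (φ j)) W hpt
  obtain ⟨t₀, ht₀, x₀, -, hx₀⟩ := hWsing 1 one_pos 0
  have hWne : W t₀ x₀ ≠ 0 := fun h => by simp [h] at hx₀
  -- the zoomed sequence: in the class, with the class-uniform Hessian bound
  set w : ℕ → ℝ → EuclideanSpace ℝ (Fin 3) → EuclideanSpace ℝ (Fin 3) :=
    fun j => c (φ j) • stPull (c (φ j) ^ 2) (c (φ j)) 0 0 u with hwdef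
  have hw : ∀ j, IsTypeIAncientMild C (w j) := fun j => isTypeIAncientMild_zoom hu (hc (φ j)) 0
  obtain ⟨K, -, hK⟩ := uniformBounds_exists_mixed 2 0 (-(3 : ℝ) / 2) (by norm_num)
  have h2x : ∀ n, ∀ t < 0, ∀ x, ‖iteratedFDeriv ℝ 2 (w n t) x‖ ≤ K C * (-t) ^ (-(3 : ℝ) / 2) := by
    intro n t ht x
    have := hK C (w n) (hw n) t ht x
    simpa only [iteratedDeriv_zero] using this
  -- the scales of the subsequence tend to zero
  have hc0 : Tendsto (fun n => c (φ n)) atTop (𝓝 0) :=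
    tendsto_one_div_add_atTop_nhds_zero_nat.comp hφ.tendsto_atTop
  -- convergence of curls and directions at a point of a negative slice
  have hcurl : ∀ t < 0, ∀ x, Tendsto (fun n => curl (w n t) x) atTop (𝓝 (curl (W t) x)) := by
    intro t ht x
    have hgrad : Tendsto (fun n => fderiv ℝ (w n t) x) atTop (𝓝 (fderiv ℝ (W t) x)) :=
      tendsto_clm_of_tendsto_apply fun e => tendsto_fderiv_apply_of_typeI hw hW hpt h2x ht x e
    simp only [curl_eq_curlCLM]
    exact (curlCLM.continuous.tendsto _).comp hgrad
  have hξ : ∀ t < 0, ∀ x, curl (W t) x ≠ 0 → Tendsto (fun n => vorticityDirection (curl (w n t)) x)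
      atTop (𝓝 (vorticityDirection (curl (W t)) x)) := by
    intro t ht x hωW
    simp only [vorticityDirection_apply]
    exact (((hcurl t ht x).norm).inv₀ (norm_ne_zero_iff.2 hωW)).smul (hcurl t ht x)
  -- eventually the un-zoomed vorticity at the zoomed point exceeds the threshold `d`
  have hbig : ∀ t < 0, ∀ x, curl (W t) x ≠ 0 →
      ∀ᶠ n in atTop, d < ‖curl (u (c (φ n) ^ 2 * t)) (c (φ n) • x)‖ := by
    intro t ht x hωW
    have hm : 0 < ‖curl (W t) x‖ / 2 := by positivity
    have h1 : ∀ᶠ n in atTop, ‖curl (W t) x‖ / 2 < ‖curl (w n t) x‖ :=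
      ((hcurl t ht x).norm).eventually (eventually_gt_nhds (by linarith [norm_pos_iff.2 hωW]))
    have h2 : ∀ᶠ n in atTop, c (φ n) * c (φ n) * d < ‖curl (W t) x‖ / 2 := by
      have hlim : Tendsto (fun n => c (φ n) * c (φ n) * d) atTop (𝓝 (0 * 0 * d)) :=
        (hc0.mul hc0).mul_const d
      rw [zero_mul, zero_mul] at hlim
      exact hlim.eventually (eventually_lt_nhds hm)
    filter_upwards [h1, h2] with n hn1 hn2
    have hcc : 0 < c (φ n) * c (φ n) := mul_pos (hc (φ n)) (hc (φ n))
    have hnorm : ‖curl (w n t) x‖ = (c (φ n) * c (φ n)) * ‖curl (u (c (φ n) ^ 2 * t)) (c (φ n) • x)‖ :=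
      norm_curl_nsZoom_origin (hc (φ n)) u t x
    rw [hnorm] at hn1
    by_contra hle
    push Not at hle
    have : c (φ n) * c (φ n) * ‖curl (u (c (φ n) ^ 2 * t)) (c (φ n) • x)‖ ≤ c (φ n) * c (φ n) * d :=
      mul_le_mul_of_nonneg_left hle hcc.le
    linarith
  -- every negative slice of the limit has unidirectional vorticity
  have hdirW : ∀ t < 0, ∃ e : EuclideanSpace ℝ (Fin 3), e ≠ 0 ∧ ∀ y, ∃ a : ℝ, curl (W t) y = a • e := by
    intro t ht
    refine exists_parallel_of_direction_eq fun x y hx hy => ?_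
    rcases eq_or_ne x y with rfl | hxy
    · rfl
    -- the modulus at the zoomed separation tends to zero
    have hsep : 0 < ‖x - y‖ := norm_pos_iff.2 (sub_ne_zero.2 hxy)
    have hηn : Tendsto (fun n => η (c (φ n) * ‖x - y‖)) atTop (𝓝 0) := by
      refine hη.comp (tendsto_nhdsWithin_iff.2 ⟨?_, Eventually.of_forall fun n => ?_⟩)
      · simpa using hc0.mul_const ‖x - y‖
      · exact mul_pos (hc (φ n)) hsep
    -- the zoomed times enter the slab `(-1, 0)`
    have hct : Tendsto (fun n => c (φ n) ^ 2 * t) atTop (𝓝 0) := by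
      have := (hc0.pow 2).mul_const t
      simpa using this
    have hevT : ∀ᶠ n in atTop, -1 < c (φ n) ^ 2 * t := hct.eventually (eventually_gt_nhds (by norm_num))
    -- the alignment bound along the zooms
    have hev : ∀ᶠ n in atTop, ‖vorticityDirection (curl (w n t)) x - vorticityDirection (curl (w n t)) y‖
        ≤ η (c (φ n) * ‖x - y‖) := by
      filter_upwards [hevT, hbig t ht x hx, hbig t ht y hy] with n hnT hnx hny
      have hcn : 0 < c (φ n) := hc (φ n)
      have hct0 : c (φ n) ^ 2 * t < 0 := mul_neg_of_pos_of_neg (by positivity) ht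
      have key := halign (c (φ n) ^ 2 * t) ⟨hnT, hct0⟩ (c (φ n) • x) (c (φ n) • y) hnx hny
      have hdist : ‖c (φ n) • x - c (φ n) • y‖ = c (φ n) * ‖x - y‖ := by
        rw [← smul_sub, norm_smul, Real.norm_of_nonneg hcn.le]
      rw [hdist] at key
      show ‖vorticityDirection (curl ((c (φ n) • stPull (c (φ n) ^ 2) (c (φ n)) 0 0 u) t)) x -
          vorticityDirection (curl ((c (φ n) • stPull (c (φ n) ^ 2) (c (φ n)) 0 0 u) t)) y‖ ≤
        η (c (φ n) * ‖x - y‖)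
      rw [vorticityDirection_nsZoom_origin hcn, vorticityDirection_nsZoom_origin hcn]
      exact key
    have hlim : Tendsto (fun n => ‖vorticityDirection (curl (w n t)) x - vorticityDirection (curl (w n t)) y‖)
        atTop (𝓝 ‖vorticityDirection (curl (W t)) x - vorticityDirection (curl (W t)) y‖) :=
      ((hξ t ht x hx).sub (hξ t ht y hy)).norm
    have hle : ‖vorticityDirection (curl (W t)) x - vorticityDirection (curl (W t)) y‖ ≤ 0 :=
      le_of_tendsto_of_tendsto hlim hηn hev
    exact sub_eq_zero.1 (norm_le_zero_iff.1 hle)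
  -- the unidirectional Liouville theorem kills the limit: contradiction with its singularity
  have hW0 : ∀ s < 0, ∀ y, W s y = 0 := unidirectionalVorticityLiouville hW hdirW
  exact hWne (hW0 t₀ ht₀.2 x₀)

/-! ### Translation covariance: regularity at every point of the final time -/

/-- Translating the domain of a set integral over a ball: `∫_{B(x₀,r)} f(x + a) dx = ∫_{B(x₀+a,r)} f`. [folklore] -/
theorem setIntegral_ball_comp_add_right {F : Type*} [NormedAddCommGroup F] [NormedSpace ℝ F]
    (f : EuclideanSpace ℝ (Fin 3) → F) (x₀ a : EuclideanSpace ℝ (Fin 3)) (r : ℝ) :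
    ∫ x in Metric.ball x₀ r, f (x + a) = ∫ y in Metric.ball (x₀ + a) r, f y := by
  have h := (measurePreserving_add_right (volume : Measure (EuclideanSpace ℝ (Fin 3))) a).setIntegral_preimage_emb
    (measurableEmbedding_addRight a) f (Metric.ball (x₀ + a) r)
  have hpre : (fun x => x + a) ⁻¹' Metric.ball (x₀ + a) r = Metric.ball x₀ r := by
    ext x
    simp [Metric.mem_ball, dist_eq_norm]
  rw [hpre] at h
  exact h

/-- **The energy ledger is translation invariant**: the scale-invariant local energies `A, E ≤ C` of
`u` on all backward cylinders below `t = 0` pass to the space translate `u(·, · + a)`. [folklore] -/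
theorem energyLedger_comp_add_right {C : ℝ}
    {u : ℝ → EuclideanSpace ℝ (Fin 3) → EuclideanSpace ℝ (Fin 3)}
    (hE : ∀ (x₀ : EuclideanSpace ℝ (Fin 3)) (t₀ r : ℝ), t₀ ≤ 0 → 0 < r →
      (∀ t, t₀ - r ^ 2 < t → t < t₀ → r⁻¹ * ∫ x in Metric.ball x₀ r, ‖u t x‖ ^ 2 ≤ C) ∧
        r⁻¹ * ∫ t in Set.Ioo (t₀ - r ^ 2) t₀, ∫ x in Metric.ball x₀ r, ‖fderiv ℝ (u t) x‖ ^ 2 ≤ C)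
    (a : EuclideanSpace ℝ (Fin 3)) :
    ∀ (x₀ : EuclideanSpace ℝ (Fin 3)) (t₀ r : ℝ), t₀ ≤ 0 → 0 < r →
      (∀ t, t₀ - r ^ 2 < t → t < t₀ →
        r⁻¹ * ∫ x in Metric.ball x₀ r, ‖(fun t x => u t (x + a)) t x‖ ^ 2 ≤ C) ∧
        r⁻¹ * ∫ t in Set.Ioo (t₀ - r ^ 2) t₀,
          ∫ x in Metric.ball x₀ r, ‖fderiv ℝ ((fun t x => u t (x + a)) t) x‖ ^ 2 ≤ C := by
  intro x₀ t₀ r ht₀ hr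
  obtain ⟨hA, hEE⟩ := hE (x₀ + a) t₀ r ht₀ hr
  refine ⟨fun t h1 h2 => ?_, ?_⟩
  · have e : ∫ x in Metric.ball x₀ r, ‖u t (x + a)‖ ^ 2 = ∫ y in Metric.ball (x₀ + a) r, ‖u t y‖ ^ 2 :=
      setIntegral_ball_comp_add_right (fun y => ‖u t y‖ ^ 2) x₀ a r
    simpa only [e] using hA t h1 h2
  · have e : ∀ t, ∫ x in Metric.ball x₀ r, ‖fderiv ℝ (fun x => u t (x + a)) x‖ ^ 2 =
        ∫ y in Metric.ball (x₀ + a) r, ‖fderiv ℝ (u t) y‖ ^ 2 := fun t => by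
      simp only [fderiv_comp_add_right]
      exact setIntegral_ball_comp_add_right (fun y => ‖fderiv ℝ (u t) y‖ ^ 2) x₀ a r
    simpa only [e] using hEE

/-- **Continuous alignment forces regularity at EVERY point of the final time** (Giga–Miura's
conclusion "bounded up to `t = 0`", pointwise): under the hypotheses of `continuousAlignmentRegular`
the element `u ∈ 𝒦_C` is bounded on some backward parabolic cylinder `Q((x₁, 0), r)` about every
`x₁ ∈ ℝ³` — apply `continuousAlignmentRegular` to the translate `u(·, · + x₁) ∈ 𝒦_C`
(`translationInvariantAfter_isTypeIAncientMild_comp_add_right`, `energyLedger_comp_add_right`; the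
alignment hypothesis is translation invariant). [cite: GigaMiura2011, Thm 1.1 (Commun. Math. Phys. 303 (2011) 289–300)] -/
theorem continuousAlignmentRegular_at {C : ℝ}
    {u : ℝ → EuclideanSpace ℝ (Fin 3) → EuclideanSpace ℝ (Fin 3)} (hu : IsTypeIAncientMild C u)
    (hE : ∀ (x₀ : EuclideanSpace ℝ (Fin 3)) (t₀ r : ℝ), t₀ ≤ 0 → 0 < r →
      (∀ t, t₀ - r ^ 2 < t → t < t₀ → r⁻¹ * ∫ x in Metric.ball x₀ r, ‖u t x‖ ^ 2 ≤ C) ∧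
        r⁻¹ * ∫ t in Set.Ioo (t₀ - r ^ 2) t₀, ∫ x in Metric.ball x₀ r, ‖fderiv ℝ (u t) x‖ ^ 2 ≤ C)
    {d : ℝ} {η : ℝ → ℝ} (hη : Tendsto η (𝓝[>] 0) (𝓝 0))
    (halign : ∀ t ∈ Set.Ioo (-1 : ℝ) 0, ∀ x y : EuclideanSpace ℝ (Fin 3),
      d < ‖curl (u t) x‖ → d < ‖curl (u t) y‖ →
        ‖vorticityDirection (curl (u t)) x - vorticityDirection (curl (u t)) y‖ ≤ η ‖x - y‖)
    (x₁ : EuclideanSpace ℝ (Fin 3)) :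
    ¬ (∀ r > 0, ∀ M : ℝ, ∃ t ∈ Set.Ioo (-(r ^ 2)) (0 : ℝ),
      ∃ x ∈ Metric.ball x₁ r, M < ‖u t x‖) := by
  intro hsing
  -- the translate and its data
  set v : ℝ → EuclideanSpace ℝ (Fin 3) → EuclideanSpace ℝ (Fin 3) := fun t x => u t (x + x₁) with hvdef
  have hv : IsTypeIAncientMild C v := translationInvariantAfter_isTypeIAncientMild_comp_add_right hu x₁
  have hEv := energyLedger_comp_add_right (C := C) hE x₁
  have hcurl : ∀ (t : ℝ) (x : EuclideanSpace ℝ (Fin 3)), curl (v t) x = curl (u t) (x + x₁) := by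
    intro t x
    simp only [hvdef, curl, fderiv_comp_add_right]
  have hξv : ∀ (t : ℝ) (x : EuclideanSpace ℝ (Fin 3)),
      vorticityDirection (curl (v t)) x = vorticityDirection (curl (u t)) (x + x₁) := by
    intro t x
    rw [vorticityDirection_apply, vorticityDirection_apply, hcurl]
  have halignv : ∀ t ∈ Set.Ioo (-1 : ℝ) 0, ∀ x y : EuclideanSpace ℝ (Fin 3),
      d < ‖curl (v t) x‖ → d < ‖curl (v t) y‖ →
        ‖vorticityDirection (curl (v t)) x - vorticityDirection (curl (v t)) y‖ ≤ η ‖x - y‖ := by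
    intro t ht x y hx hy
    rw [hcurl] at hx hy
    rw [hξv, hξv]
    have key := halign t ht (x + x₁) (y + x₁) hx hy
    rwa [add_sub_add_right_eq_sub] at key
  -- singular at `x₁` for `u` means singular at the origin for `v`
  refine continuousAlignmentRegular hv hEv hη halignv fun r hr M => ?_
  obtain ⟨t, ht, x, hx, hM⟩ := hsing r hr M
  refine ⟨t, ht, x - x₁, ?_, ?_⟩
  · rwa [Metric.mem_ball, dist_zero_right, ← dist_eq_norm, ← Metric.mem_ball]
  · simpa only [hvdef, sub_add_cancel] using hM

/-- **Stub `stub_continuousAlignmentRegular` (crux stmt-NavierStokesRegularity-10570, line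
`registered`) — Giga–Miura's Theorem 1.1 in the vocabulary of the route's class `𝒦_C`** (the
hypotheses of `ClockCeiling` verbatim): a `t`-uniform spatial modulus of continuity of the vorticity
direction on `{|ω| > d} ∩ (ℝ³ × (−1,0))` excludes a singularity at the origin. (The sign hypothesis
`0 ≤ d` of the registered form is not needed.) [cite: GigaMiura2011, Thm 1.1 (Commun. Math. Phys. 303 (2011) 289–300)] -/
theorem stub_continuousAlignmentRegular :
    ∀ (C : ℝ) (u : ℝ → EuclideanSpace ℝ (Fin 3) → EuclideanSpace ℝ (Fin 3)), (ContDiffOn ℝ (⊤ : ℕ∞) (Function.uncurry u) (Set.Iio 0 ×ˢ Set.univ) ∧ (∀ t < 0, Literature.Analysis.FluidPDE.VectorCalculus.IsDivFree (u t)) ∧ (∀ s t : ℝ, s < t → t < 0 → ∀ x, u t x = Literature.Analysis.FluidPDE.heatFlow (u s) (t - s) x - ∫ τ in Set.Ioo s t, ∫ y, ((-(inner ℝ (x - y) (u τ y) / (2 * (t - τ)) * Literature.Analysis.UnboundedOperators.heatKernel (t - τ) (x - y))) • u τ y + (∫ σ in Set.Ioi (t - τ), Literature.Analysis.UnboundedOperators.heatKernel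 σ (x - y) / (4 * σ ^ 2)) • (inner ℝ (x - y) (u τ y) • u τ y + inner ℝ (u τ y) (u τ y) • (x - y) + inner ℝ (x - y) (u τ y) • u τ y) - ((∫ σ in Set.Ioi (t - τ), Literature.Analysis.UnboundedOperators.heatKernel σ (x - y) / (8 * σ ^ 3)) * (inner ℝ (x - y) (u τ y) * inner ℝ (x - y) (u τ y))) • (x - y))) ∧ Literature.Analysis.FluidPDE.HasTypeITimeDecay C u ∧ (∀ (x₀ : EuclideanSpace ℝ (Fin 3)) (t₀ r : ℝ), t₀ ≤ 0 → 0 < r → (∀ t, t₀ - r ^ 2 < t → t < t₀ → r⁻¹ * ∫ x in Metric.ball x₀ r, ‖u t x‖ ^ 2 ≤ C) ∧ r⁻¹ * ∫ t in Set.Ioo (t₀ - r ^ 2) t₀, ∫ x in Metric.ball x₀ r, ‖fderiv ℝ (u t) x‖ ^ 2 ≤ C)) → ∀ (d : ℝ) (η : ℝ → ℝ), 0 ≤ d → Filter.Tendsto η (nhdsWithin 0 (Set.Ioi 0)) (nhds 0) → (∀ t ∈ Set.Ioo (-1 : ℝ) 0, ∀ x y : EuclideanSpace ℝ (Fin 3),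 d < ‖Literature.Analysis.FluidPDE.curl (u t) x‖ → d < ‖Literature.Analysis.FluidPDE.curl (u t) y‖ → ‖Literature.Analysis.FluidPDE.vorticityDirection (Literature.Analysis.FluidPDE.curl (u t)) x - Literature.Analysis.FluidPDE.vorticityDirection (Literature.Analysis.FluidPDE.curl (u t)) y‖ ≤ η ‖x - y‖) → ¬ (∀ r > 0, ∀ M : ℝ, ∃ t ∈ Set.Ioo (-(r ^ 2)) (0 : ℝ), ∃ x ∈ Metric.ball (0 : EuclideanSpace ℝ (Fin 3)) r, M < ‖u t x‖) := by
  intro C u hu d η _ hη halign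
  have hTI : IsTypeIAncientMild C u :=
    isTypeIAncientMild_iff.2 ⟨hu.1, hu.2.1, hu.2.2.1, hu.2.2.2.1⟩
  exact continuousAlignmentRegular hTI hu.2.2.2.2 hη halign

/-- **Stub `stub_clockCeilingOfContinuousAlignment` (crux stmt-NavierStokesRegularity-10570, line
`registered`) — `ClockCeiling` holds along every continuously aligned element of `𝒦_C`**: under
Giga–Miura's alignment hypothesis the element is regular at the origin
(`continuousAlignmentRegular`), and at a regular origin the clock amplitude is not bounded below on
`[−1, 0)` (`clockCeiling_of_regularOrigin`, p152790). [cite: GigaMiura2011, Thm 1.1] -/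
theorem stub_clockCeilingOfContinuousAlignment :
    ∀ (C : ℝ) (u : ℝ → EuclideanSpace ℝ (Fin 3) → EuclideanSpace ℝ (Fin 3)), (ContDiffOn ℝ (⊤ : ℕ∞) (Function.uncurry u) (Set.Iio 0 ×ˢ Set.univ) ∧ (∀ t < 0, Literature.Analysis.FluidPDE.VectorCalculus.IsDivFree (u t)) ∧ (∀ s t : ℝ, s < t → t < 0 → ∀ x, u t x = Literature.Analysis.FluidPDE.heatFlow (u s) (t - s) x - ∫ τ in Set.Ioo s t, ∫ y, ((-(inner ℝ (x - y) (u τ y) / (2 * (t - τ)) * Literature.Analysis.UnboundedOperators.heatKernel (t - τ) (x - y))) • u τ y + (∫ σ in Set.Ioi (t - τ), Literature.Analysis.UnboundedOperators.heatKernel σ (x - y) / (4 * σ ^ 2)) • (inner ℝ (x - y) (u τ y) • u τ y + inner ℝ (u τ y) (u τ y) • (x - y) + inner ℝ (x - y) (u τ y) • u τ y) - ((∫ σ in Set.Ioi (t - τ), Literature.Analysis.UnboundedOperators.heatKernel σ (x - y) / (8 * σ ^ 3)) * (inner ℝ (x - y) (u τ y) * inner ℝ (x - y) (u τ y))) • (x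 - y))) ∧ Literature.Analysis.FluidPDE.HasTypeITimeDecay C u ∧ (∀ (x₀ : EuclideanSpace ℝ (Fin 3)) (t₀ r : ℝ), t₀ ≤ 0 → 0 < r → (∀ t, t₀ - r ^ 2 < t → t < t₀ → r⁻¹ * ∫ x in Metric.ball x₀ r, ‖u t x‖ ^ 2 ≤ C) ∧ r⁻¹ * ∫ t in Set.Ioo (t₀ - r ^ 2) t₀, ∫ x in Metric.ball x₀ r, ‖fderiv ℝ (u t) x‖ ^ 2 ≤ C)) → ∀ (d : ℝ) (η : ℝ → ℝ), 0 ≤ d → Filter.Tendsto η (nhdsWithin 0 (Set.Ioi 0)) (nhds 0) → (∀ t ∈ Set.Ioo (-1 : ℝ) 0, ∀ x y : EuclideanSpace ℝ (Fin 3), d < ‖Literature.Analysis.FluidPDE.curl (u t) x‖ → d < ‖Literature.Analysis.FluidPDE.curl (u t) y‖ → ‖Literature.Analysis.FluidPDE.vorticityDirection (Literature.Analysis.FluidPDE.curl (u t)) x - Literature.Analysis.FluidPDE.vorticityDirection (Literature.Analysis.FluidPDE.curl (u t)) y‖ ≤ η ‖x - y‖) → ∀ δ > 0, ∃ t : ℝ,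 -1 ≤ t ∧ t < 0 ∧ (-t) ^ ((3 : ℝ) / 2) * ∫ x, ‖Literature.Analysis.FluidPDE.timeDeriv u t x‖ ^ 2 * Real.exp (-(‖x‖ ^ 2) / (4 * (-t))) < δ := by
  intro C u hu d η _ hη halign
  have hTI : IsTypeIAncientMild C u :=
    isTypeIAncientMild_iff.2 ⟨hu.1, hu.2.1, hu.2.2.1, hu.2.2.2.1⟩
  exact clockCeiling_of_regularOrigin hTI hu.2.2.2.2 (continuousAlignmentRegular hTI hu.2.2.2.2 hη halign)

end Summit.NavierStokesRegularity.NavierStokesRegularity.Theorems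

end
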